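import Literature.AlgebraicGeometry.Motives.WeilDiscriminant
import HarnessLib

/-!
# The discriminant of a Weil-type polarization is multiplicative under products (Schoen 1998 §10; Markman 2025 §11.5 Step 2)

Family `hodge`, layer `Literature/AlgebraicGeometry/Motives`; companion of `Motives/WeilDiscriminant`
(van Geemen's Hermitian form `H(x, y) = E(x, α y) + α E(x, y)` of a `ℚ`-bilinear form `E` on a
`K`-vector space, `K = ℚ(α)`, `α = √-d`, and its discriminant `det H ∈ ℚˣ ⧸ Nm(Kˣ)`,
`weilDiscriminant E α`). Sources read (held), verbatim:

* E. Markman, *Secant sheaves and Weil classes on abelian varieties*, arXiv:2509.23403, §11.5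
  Step 2 (arXiv v2 PDF p. 21, lines 37–47 = v1 p. 21, lines 17–27; quoted from the held TeX-derived corpus
  chunk p0019 — not a PDF page — whose "[van-Geemen]" the PDF prints as "[vG, Th. 5.2]"): "The discriminant invariant of polarized abelian varieties with complex
  multiplication by the same field is multiplicative under cartesian products. Every value in
  `ℚˣ/Nm_{K/ℚ}(Kˣ)` is realized as the discriminant by some connected component of moduli in every
  even dimension [van-Geemen]. Hence, for every polarized abelian fourfold `(A₁,η₁,h₁)` of Weil type,
  of arbitrary discriminant, there exists a polarized abelian surface of Weil type `(A₂,η₂,h₂)`, such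
  that the discriminant of their product polarized abelian sixfold of Weil type
  `(A₁ × A₂, η, π₁^*h₁ + π₂^*h₂)` is the coset of `-1`."
* C. Schoen, *Addendum to: Hodge classes on self-products of a variety with an automorphism*,
  Compositio Math. 114 (1998), §2 (p. 330): "Set `f = disc(φ)`" for
  "`φ(·,·) := ψ(α·,·) + α ψ(·,·)` […] a non-degenerate `K/ℚ`-Hermitian form"; §10, proof of the
  Proposition (pp. 332–333): "Choose `f' ∈ ℚˣ/N_ℚ^K Kˣ` such that `f' f_A = f`. By 7 there exists a
  Weil pair of rank `2`, `(V'_ℤ, ψ')` with invariant `(1, f')`. […] The Weil pair associated to the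
  product `A × A'` is `(H₁(A; ℤ) ⊕ V'_ℤ, ψ_A ⊕ ψ')`. By 7 there is an isometry of Hermitian inner
  product spaces `(H₁(A; ℚ) ⊕ V'_ℚ, φ_A ⊕ φ') → (V_ℚ, φ)`".
* B. van Geemen, LNM 1594 (1994), Lemma 5.2 (2)–(3): `H` is `K`-linear in the second factor and
  Hermitian; `det H ∈ ℚˣ/Nm(Kˣ)` "does not depend on the choice of the `K`-basis".

## What is here (everything PROVED; the four definitions are data with `rfl` unfoldings)

* `formOrthSum`, `sesqOrthSum`, `bilinOrthSum` — the orthogonal sum `B₁ ⊕ B₂` of two forms on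
  `V₁ × V₂` (as functions / `σ`-sesquilinear maps / `ℚ`-bilinear forms), "`ψ_A ⊕ ψ'`";
  `gramMatrix_formOrthSum_prod` (block-diagonal Gram matrix in a product basis),
  `det_gramMatrix_formOrthSum_prod`, `normResidueClass_algebraMap_mul_algebraMap`, and
  `discrClass_sesqOrthSum`: **`discr(B₁ ⊕ B₂) = discr B₁ · discr B₂`** in `Fˣ ⧸ Nm(Kˣ)` for
  `σ`-sesquilinear forms with Gram determinants in `Fˣ`.
* `weilSesqForm` — van Geemen's `H = weilHermitianForm E α` BUNDLED as a `σ`-sesquilinear form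
  (`σ` the conjugation of `K = ℚ + ℚα`: `σ α = -α`), from `α² = -d ≠ 0` and `E(α x, α y) = d E(x, y)`;
  `map_weilHermitianForm_eq_swap` (`σ H(x,y) = H(y,x)`), `map_det_gramMatrix_weilHermitianForm`
  (`σ det Ψ = det Ψ`), `exists_eq_algebraMap_of_map_eq` (`σ`-fixed ⟹ rational),
  `det_gramMatrix_weilHermitianForm_ne_zero` (non-degenerate `E` ⟹ `det Ψ ≠ 0`),
  `exists_units_algebraMap_eq_det_gramMatrix` (**`det Ψ ∈ ℚˣ`**, van Geemen 5.2 (3)).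
* `weilHermitianForm_bilinOrthSum` (`H_{E₁ ⊕ E₂} = H_{E₁} ⊕ H_{E₂}`) and the printed statement
  `weilDiscriminant_bilinOrthSum`: **`det H_{E₁ ⊕ E₂} = det H_{E₁} · det H_{E₂}` in `ℚˣ ⧸ Nm(Kˣ)`**
  for alternating non-degenerate Weil-type `E₁`, `E₂` and `d > 0`.

Not here: the realisation of every class as a discriminant in every even dimension ("[van-Geemen]";
Schoen §7 "[De–M, p. 50]" and §§3–5, the abelian variety of a Weil pair), and the identification
of `H₁((A₁ × A₂)(ℂ), ℚ)` with `H₁(A₁(ℂ), ℚ) ⊕ H₁(A₂(ℂ), ℚ)` carrying `ψ_A ⊕ ψ'` (no Riemann form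
on the tree's real carriers; module docstring of `HodgeTheory/WeilClasses`). The hypotheses on
`(K, α, σ)` are stated elementarily (`α² = -d`, `K = ℚ + ℚ α`, `σ α = -α`, `k σ(k) = Nm(k)`) rather
than derived from `NumberField K`, matching `Motives/WeilDiscriminant`.

## References

* [Markman2025SurveySecant] E. Markman, Secant sheaves and Weil classes on abelian varieties,
  arXiv:2509.23403, §11.5 Step 2.
* [Schoen1998HodgeWeilAddendum] C. Schoen, Addendum to: Hodge classes on self-products of a
  variety with an automorphism, Compositio Math. 114 (1998) 329–336, §2, §7, §10.
* [vanGeemen1994HodgeAV] B. van Geemen, An introduction to the Hodge conjecture for abelian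
  varieties, LNM 1594 (1994), Lemma 5.2.
* [Markman2025SecantWeil] E. Markman, arXiv:2502.03415, §1.1 (the discriminant).
-/

noncomputable section

open Module
open scoped Matrix

namespace Literature.AlgebraicGeometry.Motives

universe u

/-! ### Orthogonal sums of forms and their Gram matrices -/

section FormOrthSum

variable {K : Type*} {V₁ V₂ : Type*}

/-- The **orthogonal (direct) sum** `B₁ ⊕ B₂` of two `K`-valued forms, on `V₁ × V₂`:
`(B₁ ⊕ B₂)((x₁,x₂),(y₁,y₂)) = B₁(x₁,y₁) + B₂(x₂,y₂)` (Schoen 1998, §10: "The Weil pair associated to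
the product `A × A'` is `(H₁(A; ℤ) ⊕ V'_ℤ, ψ_A ⊕ ψ')`"). [cite: Schoen1998HodgeWeilAddendum, §10 (proof of the Proposition)] -/
def formOrthSum [Add K] (B₁ : V₁ → V₁ → K) (B₂ : V₂ → V₂ → K) : V₁ × V₂ → V₁ × V₂ → K :=
  fun x y => B₁ x.1 y.1 + B₂ x.2 y.2

/-- The defining formula of `formOrthSum`. [folklore] -/
@[simp]
theorem formOrthSum_apply [Add K] (B₁ : V₁ → V₁ → K) (B₂ : V₂ → V₂ → K) (x y : V₁ × V₂) :
    formOrthSum B₁ B₂ x y = B₁ x.1 y.1 + B₂ x.2 y.2 := rfl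

variable [CommRing K] [AddCommGroup V₁] [Module K V₁] [AddCommGroup V₂] [Module K V₂]
  {ι₁ ι₂ : Type*}

/-- **The Gram matrix of an orthogonal sum in a product basis is block diagonal**:
`Gram_{b₁ ⊔ b₂}(B₁ ⊕ B₂) = diag(Gram_{b₁} B₁, Gram_{b₂} B₂)`, for forms vanishing when either
argument is `0` (e.g. additive in each argument). [folklore] -/
theorem gramMatrix_formOrthSum_prod (B₁ : V₁ → V₁ → K) (B₂ : V₂ → V₂ → K)
    (h₁ : ∀ x, B₁ x 0 = 0) (h₁' : ∀ y, B₁ 0 y = 0) (h₂ : ∀ x, B₂ x 0 = 0) (h₂' : ∀ y, B₂ 0 y = 0)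
    (b₁ : Basis ι₁ K V₁) (b₂ : Basis ι₂ K V₂) :
    gramMatrix (formOrthSum B₁ B₂) ⇑(b₁.prod b₂) =
      Matrix.fromBlocks (gramMatrix B₁ b₁) 0 0 (gramMatrix B₂ b₂) := by
  ext (i | i) (j | j) <;> simp [gramMatrix_apply, Basis.prod_apply, h₁, h₁', h₂, h₂']

/-- Hence `det Gram_{b₁ ⊔ b₂}(B₁ ⊕ B₂) = det Gram_{b₁} B₁ · det Gram_{b₂} B₂`. [folklore] -/
theorem det_gramMatrix_formOrthSum_prod [Fintype ι₁] [Fintype ι₂] [DecidableEq ι₁] [DecidableEq ι₂]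
    (B₁ : V₁ → V₁ → K) (B₂ : V₂ → V₂ → K)
    (h₁ : ∀ x, B₁ x 0 = 0) (h₁' : ∀ y, B₁ 0 y = 0) (h₂ : ∀ x, B₂ x 0 = 0) (h₂' : ∀ y, B₂ 0 y = 0)
    (b₁ : Basis ι₁ K V₁) (b₂ : Basis ι₂ K V₂) :
    (gramMatrix (formOrthSum B₁ B₂) ⇑(b₁.prod b₂)).det =
      (gramMatrix B₁ b₁).det * (gramMatrix B₂ b₂).det := by
  rw [gramMatrix_formOrthSum_prod B₁ B₂ h₁ h₁' h₂ h₂', Matrix.det_fromBlocks_zero₂₁]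

end FormOrthSum

/-! ### The norm residue class is multiplicative on `Fˣ` -/

section NormResidueMul

variable (F : Type*) {K : Type*} [Field F] [Field K] [Algebra F K]

/-- `[u v] = [u] [v]` in `Fˣ ⧸ Nm(Kˣ)` for `u, v ∈ Fˣ` (the class map is the quotient map on the
image of `Fˣ`). [folklore] -/
theorem normResidueClass_algebraMap_mul_algebraMap (u v : Fˣ) :
    normResidueClass F (algebraMap F K u * algebraMap F K v) =
      normResidueClass F (algebraMap F K u) * normResidueClass F (algebraMap F K v) := by
  rw [← map_mul, ← Units.val_mul, normResidueClass_algebraMap, normResidueClass_algebraMap,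
    normResidueClass_algebraMap, QuotientGroup.mk_mul]

end NormResidueMul

/-! ### Discriminant classes of orthogonal sums of sesquilinear forms -/

section SesqOrthSum

variable (F : Type*) {K V₁ V₂ : Type*} [Field F] [Field K] [Algebra F K] [AddCommGroup V₁] [Module K V₁]
  [AddCommGroup V₂] [Module K V₂] {σ : K →+* K}

/-- The orthogonal sum of two `σ`-sesquilinear forms, bundled as a `σ`-sesquilinear form on
`V₁ × V₂`. [folklore] -/
def sesqOrthSum (B₁ : V₁ →ₛₗ[σ] V₁ →ₗ[K] K) (B₂ : V₂ →ₛₗ[σ] V₂ →ₗ[K] K) :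
    (V₁ × V₂) →ₛₗ[σ] (V₁ × V₂) →ₗ[K] K :=
  (LinearMap.lcomp K K (LinearMap.fst K V₁ V₂)).comp (B₁.comp (LinearMap.fst K V₁ V₂)) +
    (LinearMap.lcomp K K (LinearMap.snd K V₁ V₂)).comp (B₂.comp (LinearMap.snd K V₁ V₂))

variable {F}

/-- `sesqOrthSum B₁ B₂ (x₁,x₂) (y₁,y₂) = B₁ x₁ y₁ + B₂ x₂ y₂`. [folklore] -/
@[simp]
theorem sesqOrthSum_apply (B₁ : V₁ →ₛₗ[σ] V₁ →ₗ[K] K) (B₂ : V₂ →ₛₗ[σ] V₂ →ₗ[K] K) (x y : V₁ × V₂) :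
    sesqOrthSum B₁ B₂ x y = B₁ x.1 y.1 + B₂ x.2 y.2 := rfl

/-- As a function of two variables, `sesqOrthSum B₁ B₂` is `formOrthSum` of the two forms. [folklore] -/
theorem sesqOrthSum_eq_formOrthSum (B₁ : V₁ →ₛₗ[σ] V₁ →ₗ[K] K) (B₂ : V₂ →ₛₗ[σ] V₂ →ₗ[K] K) :
    (fun x y => sesqOrthSum B₁ B₂ x y) = formOrthSum (fun x y => B₁ x y) (fun x y => B₂ x y) := rfl

variable (F) in
/-- **The discriminant class is multiplicative under orthogonal sums**: for `σ`-sesquilinear forms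
`B₁`, `B₂` (`k · σ(k) = Nm_{K/F}(k)`) whose Gram determinants lie in `Fˣ`,
`discr(B₁ ⊕ B₂) = discr(B₁) · discr(B₂)` in `Fˣ ⧸ Nm(Kˣ)` — compute in the product basis
(`discrClass_eq_of_basis`), where the Gram matrix is block diagonal. (Schoen 1998, §10: "Choose
`f'` such that `f' f_A = f`" for the invariant of `(H₁(A; ℤ) ⊕ V'_ℤ, ψ_A ⊕ ψ')`; Markman 2025
§11.5 Step 2: "The discriminant invariant … is multiplicative under cartesian products.")
[cite: Schoen1998HodgeWeilAddendum, §10 (proof of the Proposition)] [cite: Markman2025SurveySecant, §11.5 Step 2] -/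
theorem discrClass_sesqOrthSum [Module.Finite K V₁] [Module.Finite K V₂]
    (hσ : ∀ k : K, k * σ k = algebraMap F K (Algebra.norm F k))
    (B₁ : V₁ →ₛₗ[σ] V₁ →ₗ[K] K) (B₂ : V₂ →ₛₗ[σ] V₂ →ₗ[K] K)
    (h₁ : ∃ u : Fˣ, algebraMap F K u =
      (gramMatrix (fun x y => B₁ x y) ⇑(Module.finBasis K V₁)).det)
    (h₂ : ∃ u : Fˣ, algebraMap F K u =
      (gramMatrix (fun x y => B₂ x y) ⇑(Module.finBasis K V₂)).det) :
    discrClass F (fun x y => sesqOrthSum B₁ B₂ x y) =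
      discrClass F (fun x y => B₁ x y) * discrClass F (fun x y => B₂ x y) := by
  rw [discrClass_eq_of_basis F hσ (sesqOrthSum B₁ B₂)
      ((Module.finBasis K V₁).prod (Module.finBasis K V₂)),
    sesqOrthSum_eq_formOrthSum,
    det_gramMatrix_formOrthSum_prod _ _ (fun x => by simp) (fun y => by simp) (fun x => by simp)
      (fun y => by simp),
    discrClass_def, discrClass_def]
  obtain ⟨u, hu⟩ := h₁
  obtain ⟨v, hv⟩ := h₂
  rw [← hu, ← hv, normResidueClass_algebraMap_mul_algebraMap]

end SesqOrthSum

/-! ### Van Geemen's Hermitian form `H` as a `σ`-sesquilinear form -/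

section WeilSesq

variable {K : Type*} [Field K] [Algebra ℚ K] {V : Type u} [AddCommGroup V] [Module ℚ V]
  [Module K V]

/-- `H` is additive in the first variable. [folklore] -/
theorem weilHermitianForm_add_left (E : LinearMap.BilinForm ℚ V) (α : K) (x x' y : V) :
    weilHermitianForm E α (x + x') y = weilHermitianForm E α x y + weilHermitianForm E α x' y := by
  simp only [weilHermitianForm_apply, map_add, LinearMap.add_apply]
  ring

/-- `H` is additive in the second variable. [folklore] -/
theorem weilHermitianForm_add_right (E : LinearMap.BilinForm ℚ V) (α : K) (x y y' : V) :
    weilHermitianForm E α x (y + y') = weilHermitianForm E α x y + weilHermitianForm E α x y' := by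
  simp only [weilHermitianForm_apply, smul_add, map_add]
  ring

/-- `H(a x, y) = a H(x, y)` for `a ∈ ℚ`. [folklore] -/
theorem weilHermitianForm_ratSmul_left (E : LinearMap.BilinForm ℚ V) (α : K) (a : ℚ) (x y : V) :
    weilHermitianForm E α (a • x) y = algebraMap ℚ K a * weilHermitianForm E α x y := by
  simp only [weilHermitianForm_apply, map_smul, LinearMap.smul_apply, smul_eq_mul, map_mul]
  ring

/-- `H(x, a y) = a H(x, y)` for `a ∈ ℚ`. [folklore] -/
theorem weilHermitianForm_ratSmul_right (E : LinearMap.BilinForm ℚ V) (α : K) (a : ℚ) (x y : V) :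
    weilHermitianForm E α x (a • y) = algebraMap ℚ K a * weilHermitianForm E α x y := by
  simp only [weilHermitianForm_apply, smul_comm α a y, map_smul, smul_eq_mul, map_mul]
  ring

variable [IsScalarTower ℚ K V]

/-- `H(α x, y) = d E(x, y) - α E(x, α y)` when `α² = -d ≠ 0` and `E(α x, α y) = d E(x, y)`
(so that `E(α x, y) = -E(x, α y)`, `apply_smul_left_of_weil`). [cite: vanGeemen1994HodgeAV, Lemma 5.2 (2)] -/
theorem weilHermitianForm_smul_left (E : LinearMap.BilinForm ℚ V) {α : K} {d : ℚ} (hd : d ≠ 0)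
    (hα : α * α = algebraMap ℚ K (-d)) (hW : ∀ x y : V, E (α • x) (α • y) = d * E x y) (x y : V) :
    weilHermitianForm E α (α • x) y =
      algebraMap ℚ K (d * E x y) - α * algebraMap ℚ K (E x (α • y)) := by
  rw [weilHermitianForm_apply, hW, apply_smul_left_of_weil E hd hα hW, map_neg]
  ring

/-- **Van Geemen's `H` is `σ`-sesquilinear** for `σ` the conjugation of `K = ℚ(α)`, `α = √-d`:
`K`-linear in the second variable ("`H` is `K`-linear in the second factor", Lemma 5.2 (2)) and
`σ`-semilinear in the first (`H(y, x) = σ H(x, y)` and linearity in `y`). Hypotheses: `α² = -d`,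
`d ≠ 0`, `E(α x, α y) = d E(x, y)` (`(√-d)^* E = d E`), `σ` a ring endomorphism of `K` with
`σ α = -α`, and `K = ℚ + ℚ α`. The underlying function is `weilHermitianForm E α`
(`weilSesqForm_apply`). [cite: vanGeemen1994HodgeAV, Lemma 5.2 (2)] -/
def weilSesqForm (E : LinearMap.BilinForm ℚ V) {α : K} {d : ℚ} (σ : K →+* K) (hd : d ≠ 0)
    (hα : α * α = algebraMap ℚ K (-d)) (hW : ∀ x y : V, E (α • x) (α • y) = d * E x y)
    (hσα : σ α = -α) (hK : ∀ k : K, ∃ a b : ℚ, k = algebraMap ℚ K a + algebraMap ℚ K b * α) :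
    V →ₛₗ[σ] V →ₗ[K] K where
  toFun x :=
    { toFun := fun y => weilHermitianForm E α x y
      map_add' := fun y y' => weilHermitianForm_add_right E α x y y'
      map_smul' := fun k y => by
        obtain ⟨a, b, rfl⟩ := hK k
        rw [RingHom.id_apply, smul_eq_mul, add_smul, mul_smul, algebraMap_smul, algebraMap_smul,
          weilHermitianForm_add_right, weilHermitianForm_ratSmul_right,
          weilHermitianForm_ratSmul_right, weilHermitianForm_smul_right E hα]
        ring }
  map_add' x x' := by
    ext y
    exact weilHermitianForm_add_left E α x x' y
  map_smul' k x := by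
    ext y
    obtain ⟨a, b, rfl⟩ := hK k
    simp only [LinearMap.coe_mk, AddHom.coe_mk, LinearMap.smul_apply, smul_eq_mul]
    rw [add_smul, mul_smul, algebraMap_smul, algebraMap_smul, weilHermitianForm_add_left,
      weilHermitianForm_ratSmul_left, weilHermitianForm_ratSmul_left,
      weilHermitianForm_smul_left E hd hα hW, weilHermitianForm_apply]
    have hα' : α * α = ((-d : ℚ) : K) := by rw [hα, eq_ratCast]
    simp only [map_add, map_mul, hσα, eq_ratCast, map_ratCast, Rat.cast_neg] at hα' ⊢
    linear_combination ((b : K) * ((E x y : ℚ) : K)) * hα'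

/-- The underlying function of `weilSesqForm` is `weilHermitianForm E α` (`rfl`). [folklore] -/
@[simp]
theorem weilSesqForm_apply (E : LinearMap.BilinForm ℚ V) {α : K} {d : ℚ} (σ : K →+* K) (hd : d ≠ 0)
    (hα : α * α = algebraMap ℚ K (-d)) (hW : ∀ x y : V, E (α • x) (α • y) = d * E x y)
    (hσα : σ α = -α) (hK : ∀ k : K, ∃ a b : ℚ, k = algebraMap ℚ K a + algebraMap ℚ K b * α)
    (x y : V) : weilSesqForm E σ hd hα hW hσα hK x y = weilHermitianForm E α x y := rfl

/-- As a function of two variables, `weilSesqForm` is `weilHermitianForm E α` (`rfl`). [folklore] -/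
theorem weilSesqForm_coe (E : LinearMap.BilinForm ℚ V) {α : K} {d : ℚ} (σ : K →+* K) (hd : d ≠ 0)
    (hα : α * α = algebraMap ℚ K (-d)) (hW : ∀ x y : V, E (α • x) (α • y) = d * E x y)
    (hσα : σ α = -α) (hK : ∀ k : K, ∃ a b : ℚ, k = algebraMap ℚ K a + algebraMap ℚ K b * α) :
    (fun x y => weilSesqForm E σ hd hα hW hσα hK x y) = weilHermitianForm E α := rfl

end WeilSesq

/-! ### The Gram determinant of `H` is a non-zero rational number -/

section WeilDet

variable {K : Type*} [Field K] [Algebra ℚ K] {V : Type u} [AddCommGroup V] [Module ℚ V]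
  [Module K V] [IsScalarTower ℚ K V]

/-- **`H` is Hermitian for `σ`**: `σ H(x, y) = H(y, x)` (van Geemen 1994, Lemma 5.2 (2):
"`H(y, x) = conj H(x, y)`"), for `E` alternating, `α² = -d ≠ 0`, `E(α x, α y) = d E(x, y)` and
`σ α = -α`. [cite: vanGeemen1994HodgeAV, Lemma 5.2 (2)] -/
theorem map_weilHermitianForm_eq_swap (E : LinearMap.BilinForm ℚ V) {α : K} {d : ℚ} (σ : K →+* K)
    (hd : d ≠ 0) (hα : α * α = algebraMap ℚ K (-d)) (hE : ∀ x y : V, E y x = -E x y)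
    (hW : ∀ x y : V, E (α • x) (α • y) = d * E x y) (hσα : σ α = -α) (x y : V) :
    σ (weilHermitianForm E α x y) = weilHermitianForm E α y x := by
  rw [weilHermitianForm_swap E hd hα hE hW x y, weilHermitianForm_apply, map_add, map_mul, hσα,
    eq_ratCast, eq_ratCast, map_ratCast, map_ratCast]
  ring

/-- The Gram matrix `Ψ = (H(bᵢ, bⱼ))` of `H` is `σ`-Hermitian: `Ψᵀ = σ(Ψ)`. [cite: vanGeemen1994HodgeAV, Lemma 5.2 (2)–(3)] -/
theorem transpose_gramMatrix_weilHermitianForm {ι : Type*} (E : LinearMap.BilinForm ℚ V) {α : K}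
    {d : ℚ} (σ : K →+* K) (hd : d ≠ 0) (hα : α * α = algebraMap ℚ K (-d))
    (hE : ∀ x y : V, E y x = -E x y) (hW : ∀ x y : V, E (α • x) (α • y) = d * E x y)
    (hσα : σ α = -α) (b : ι → V) :
    (gramMatrix (weilHermitianForm E α) b)ᵀ = (gramMatrix (weilHermitianForm E α) b).map σ := by
  ext i j
  simp only [Matrix.transpose_apply, Matrix.map_apply, gramMatrix_apply]
  exact (map_weilHermitianForm_eq_swap E σ hd hα hE hW hσα (b i) (b j)).symm

/-- Hence `σ(det Ψ) = det Ψ`: "the determinant of a Hermitian matrix is fixed by the involution"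
(van Geemen 1994, Lemma 5.2 (3); Markman 2025 §1.1: "the determinant … is an element of `ℚ^×`").
[cite: vanGeemen1994HodgeAV, Lemma 5.2 (3)] -/
theorem map_det_gramMatrix_weilHermitianForm {ι : Type*} [Fintype ι] [DecidableEq ι]
    (E : LinearMap.BilinForm ℚ V) {α : K} {d : ℚ} (σ : K →+* K) (hd : d ≠ 0)
    (hα : α * α = algebraMap ℚ K (-d)) (hE : ∀ x y : V, E y x = -E x y)
    (hW : ∀ x y : V, E (α • x) (α • y) = d * E x y) (hσα : σ α = -α) (b : ι → V) :
    σ (gramMatrix (weilHermitianForm E α) b).det = (gramMatrix (weilHermitianForm E α) b).det := by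
  rw [RingHom.map_det, RingHom.mapMatrix_apply,
    ← transpose_gramMatrix_weilHermitianForm E σ hd hα hE hW hσα b, Matrix.det_transpose]

omit [IsScalarTower ℚ K V] in
/-- In `K = ℚ + ℚ α` with `σ α = -α ≠ 0`, the elements fixed by `σ` are rational. [folklore] -/
theorem exists_eq_algebraMap_of_map_eq {α : K} {d : ℚ} (σ : K →+* K) (hd : d ≠ 0)
    (hα : α * α = algebraMap ℚ K (-d)) (hσα : σ α = -α)
    (hK : ∀ k : K, ∃ a b : ℚ, k = algebraMap ℚ K a + algebraMap ℚ K b * α) {k : K}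
    (hk : σ k = k) : ∃ a : ℚ, k = algebraMap ℚ K a := by
  haveI : CharZero K := charZero_of_injective_algebraMap (algebraMap ℚ K).injective
  obtain ⟨a, b, rfl⟩ := hK k
  have hα0 : α ≠ 0 := by
    rintro rfl
    rw [zero_mul, eq_comm, map_eq_zero_iff _ (algebraMap ℚ K).injective, neg_eq_zero] at hα
    exact hd hα
  simp only [map_add, map_mul, hσα, eq_ratCast, map_ratCast] at hk
  have hb : (b : K) * α = 0 := by linear_combination (-(1 : K) / 2) * hk
  have hb' : b = 0 := by
    rcases mul_eq_zero.mp hb with h | h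
    · exact_mod_cast h
    · exact absurd h hα0
  exact ⟨a, by rw [hb', map_zero, zero_mul, add_zero]⟩

omit [IsScalarTower ℚ K V] in
/-- `1, α` are linearly independent over `ℚ` when `α² = -d < 0`: `p + α q = 0 ⟹ p = q = 0`
(`α` would otherwise be the rational number `-p/q` with non-negative square `-d`). [folklore] -/
theorem eq_zero_of_algebraMap_add_mul_algebraMap_eq_zero {α : K} {d : ℚ} (hd : 0 < d)
    (hα : α * α = algebraMap ℚ K (-d)) {p q : ℚ}
    (h : algebraMap ℚ K p + α * algebraMap ℚ K q = 0) : p = 0 ∧ q = 0 := by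
  by_cases hq : q = 0
  · subst hq
    rw [map_zero, mul_zero, add_zero, map_eq_zero_iff _ (algebraMap ℚ K).injective] at h
    exact ⟨h, rfl⟩
  · exfalso
    have hq' : algebraMap ℚ K q ≠ 0 := by
      rwa [Ne, map_eq_zero_iff _ (algebraMap ℚ K).injective]
    have hαq : α = algebraMap ℚ K (-p / q) := by
      rw [map_div₀, map_neg, eq_div_iff hq']
      linear_combination h
    have hsq : (-p / q) * (-p / q) = -d :=
      (algebraMap ℚ K).injective (by rw [map_mul, ← hαq, hα])
    nlinarith [mul_self_nonneg (-p / q)]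

omit [IsScalarTower ℚ K V] in
/-- `H(x, y) = 0 ⟹ E(x, y) = 0` (and `E(x, α y) = 0`): `H(x, y) = E(x, α y) + α E(x, y)` with
`1, α` independent over `ℚ`. [cite: vanGeemen1994HodgeAV, Lemma 5.2 (2)] -/
theorem apply_eq_zero_of_weilHermitianForm_eq_zero (E : LinearMap.BilinForm ℚ V) {α : K} {d : ℚ}
    (hd : 0 < d) (hα : α * α = algebraMap ℚ K (-d)) {x y : V}
    (h : weilHermitianForm E α x y = 0) : E x y = 0 :=
  (eq_zero_of_algebraMap_add_mul_algebraMap_eq_zero hd hα h).2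

/-- **`det Ψ ≠ 0` for non-degenerate `E`**: if `Ψ v = 0` then `H(bᵢ, y) = 0` for `y = Σ vⱼ bⱼ`
and all `i`, so `H(x, y) = 0` for all `x` (`σ`-semilinearity), so `E(x, y) = 0` for all `x`, so
`y = 0` and `v = 0`. [cite: vanGeemen1994HodgeAV, Lemma 5.2 (2)–(3)] -/
theorem det_gramMatrix_weilHermitianForm_ne_zero {ι : Type*} [Fintype ι] [DecidableEq ι]
    (E : LinearMap.BilinForm ℚ V) {α : K} {d : ℚ} (σ : K →+* K) (hd : 0 < d)
    (hα : α * α = algebraMap ℚ K (-d)) (hW : ∀ x y : V, E (α • x) (α • y) = d * E x y)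
    (hN : E.Nondegenerate) (hσα : σ α = -α)
    (hK : ∀ k : K, ∃ a b : ℚ, k = algebraMap ℚ K a + algebraMap ℚ K b * α) (b : Basis ι K V) :
    (gramMatrix (weilHermitianForm E α) b).det ≠ 0 := by
  intro hdet
  obtain ⟨v, hv, hmul⟩ := Matrix.exists_mulVec_eq_zero_iff.mpr hdet
  set y : V := ∑ j, v j • b j with hy
  -- `H(bᵢ, y) = (Ψ v)ᵢ = 0`, by `K`-linearity of `H` in the second variable
  have h1 : ∀ i, weilSesqForm E σ hd.ne' hα hW hσα hK (b i) y = 0 := fun i => by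
    have hi := congrFun hmul i
    simp only [Matrix.mulVec, dotProduct, gramMatrix_apply, Pi.zero_apply] at hi
    rw [hy, map_sum]
    simp only [map_smul, smul_eq_mul, weilSesqForm_apply]
    simpa only [mul_comm] using hi
  -- `H(x, y) = 0` for every `x`, by `σ`-semilinearity in the first variable
  have h2 : (weilSesqForm E σ hd.ne' hα hW hσα hK).flip y = 0 :=
    b.ext fun i => by rw [LinearMap.flip_apply, LinearMap.zero_apply, h1 i]
  -- `E(x, y) = 0` for every `x`, so `y = 0`, so `v = 0`
  have h3 : ∀ x, E x y = 0 := fun x =>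
    apply_eq_zero_of_weilHermitianForm_eq_zero E hd hα (x := x) (y := y) (by
      rw [← weilSesqForm_apply E σ hd.ne' hα hW hσα hK, ← LinearMap.flip_apply, h2,
        LinearMap.zero_apply])
  have hy0 : y = 0 := hN.2 y h3
  apply hv
  have hy' : b.equivFun.symm v = 0 := by rw [Basis.equivFun_symm_apply, ← hy, hy0]
  exact (LinearEquiv.map_eq_zero_iff _).mp hy'

/-- **`det Ψ ∈ ℚˣ`** (van Geemen 1994, Lemma 5.2 (3); Markman 2025 §1.1: "an element of `ℚ^×`"):
the Gram determinant of `H` in any `K`-basis is (the image of) a non-zero rational number — fixed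
by `σ` (Hermitian) hence rational, and non-zero for non-degenerate `E`.
[cite: vanGeemen1994HodgeAV, Lemma 5.2 (3)] [cite: Markman2025SecantWeil, §1.1] -/
theorem exists_units_algebraMap_eq_det_gramMatrix {ι : Type*} [Fintype ι] [DecidableEq ι]
    (E : LinearMap.BilinForm ℚ V) {α : K} {d : ℚ} (σ : K →+* K) (hd : 0 < d)
    (hα : α * α = algebraMap ℚ K (-d)) (hE : ∀ x y : V, E y x = -E x y)
    (hW : ∀ x y : V, E (α • x) (α • y) = d * E x y) (hN : E.Nondegenerate) (hσα : σ α = -α)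
    (hK : ∀ k : K, ∃ a b : ℚ, k = algebraMap ℚ K a + algebraMap ℚ K b * α) (b : Basis ι K V) :
    ∃ u : ℚˣ, algebraMap ℚ K u = (gramMatrix (weilHermitianForm E α) b).det := by
  obtain ⟨a, ha⟩ := exists_eq_algebraMap_of_map_eq σ hd.ne' hα hσα hK
    (map_det_gramMatrix_weilHermitianForm E σ hd.ne' hα hE hW hσα b)
  have ha0 : a ≠ 0 := by
    rintro rfl
    rw [map_zero] at ha
    exact det_gramMatrix_weilHermitianForm_ne_zero E σ hd hα hW hN hσα hK b ha
  exact ⟨Units.mk0 a ha0, by rw [Units.val_mk0, ← ha]⟩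

end WeilDet

/-! ### The discriminant of a product is the product of the discriminants -/

section Product

variable {K : Type*} [Field K] [Algebra ℚ K] {V₁ : Type u} {V₂ : Type u} [AddCommGroup V₁]
  [Module ℚ V₁] [Module K V₁] [AddCommGroup V₂] [Module ℚ V₂] [Module K V₂]

/-- The orthogonal sum `E₁ ⊕ E₂` of two `ℚ`-bilinear forms, on `V₁ × V₂` — the Riemann form
`ψ_A ⊕ ψ'` of the product polarization `π₁^* h₁ + π₂^* h₂` on `H₁(A₁ × A₂) = H₁(A₁) ⊕ H₁(A₂)`
(Schoen 1998 §10; Markman 2025 §11.5 Step 2). [cite: Schoen1998HodgeWeilAddendum, §10 (proof of the Proposition)] -/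
def bilinOrthSum (E₁ : LinearMap.BilinForm ℚ V₁) (E₂ : LinearMap.BilinForm ℚ V₂) :
    LinearMap.BilinForm ℚ (V₁ × V₂) :=
  E₁.compl₁₂ (LinearMap.fst ℚ V₁ V₂) (LinearMap.fst ℚ V₁ V₂) +
    E₂.compl₁₂ (LinearMap.snd ℚ V₁ V₂) (LinearMap.snd ℚ V₁ V₂)

/-- `(E₁ ⊕ E₂)((x₁,x₂),(y₁,y₂)) = E₁(x₁,y₁) + E₂(x₂,y₂)`. [folklore] -/
@[simp]
theorem bilinOrthSum_apply (E₁ : LinearMap.BilinForm ℚ V₁) (E₂ : LinearMap.BilinForm ℚ V₂)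
    (x y : V₁ × V₂) : bilinOrthSum E₁ E₂ x y = E₁ x.1 y.1 + E₂ x.2 y.2 := rfl

/-- **`H` of a product is the orthogonal sum of the `H`'s**: van Geemen's Hermitian form of
`E₁ ⊕ E₂` is `H₁ ⊕ H₂` ("The Weil pair associated to the product `A × A'` is
`(H₁(A; ℤ) ⊕ V'_ℤ, ψ_A ⊕ ψ')`", whose Hermitian space is `(H₁(A; ℚ) ⊕ V'_ℚ, φ_A ⊕ φ')`).
[cite: Schoen1998HodgeWeilAddendum, §10 (proof of the Proposition)] -/
theorem weilHermitianForm_bilinOrthSum (E₁ : LinearMap.BilinForm ℚ V₁) (E₂ : LinearMap.BilinForm ℚ V₂)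
    (α : K) :
    weilHermitianForm (bilinOrthSum E₁ E₂) α =
      formOrthSum (weilHermitianForm E₁ α) (weilHermitianForm E₂ α) := by
  funext x y
  simp only [weilHermitianForm_apply, formOrthSum_apply, bilinOrthSum_apply, Prod.smul_fst,
    Prod.smul_snd, map_add]
  ring

variable [IsScalarTower ℚ K V₁] [IsScalarTower ℚ K V₂]

/-- **The Weil discriminant is multiplicative under products** (Markman 2025, §11.5 Step 2: "The
discriminant invariant of polarized abelian varieties with complex multiplication by the same field
is multiplicative under cartesian products"; Schoen 1998, §10: "Choose `f' ∈ ℚˣ/N(Kˣ)` such that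
`f' f_A = f`. […] there exists a Weil pair of rank `2`, `(V'_ℤ, ψ')` with invariant `(1, f')`. […]
The Weil pair associated to the product `A × A'` is `(H₁(A; ℤ) ⊕ V'_ℤ, ψ_A ⊕ ψ')`. By 7 there is an
isometry […] `(H₁(A; ℚ) ⊕ V'_ℚ, φ_A ⊕ φ') → (V_ℚ, φ)`"). For `K = ℚ(α)`, `α = √-d` (`d > 0`,
`α² = -d`, `K = ℚ + ℚ α`, `σ` the conjugation: `σ α = -α`, `k σ(k) = Nm(k)`), and `ℚ`-bilinear forms
`E₁`, `E₂` on `K`-vector spaces `V₁`, `V₂` which are alternating, non-degenerate and of Weil type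
(`Eᵢ(α x, α y) = d Eᵢ(x, y)`): `det H_{E₁ ⊕ E₂} = det H_{E₁} · det H_{E₂}` in `ℚˣ ⧸ Nm(Kˣ)` —
`H_{E₁ ⊕ E₂} = H_{E₁} ⊕ H_{E₂}` has block-diagonal Gram matrix in a product basis, the discriminant
class may be computed in any basis (`discrClass_eq_of_basis`, the `H`'s being `σ`-sesquilinear,
`weilSesqForm`), and the two Gram determinants are non-zero rationals
(`exists_units_algebraMap_eq_det_gramMatrix`).
[cite: Markman2025SurveySecant, §11.5 Step 2] [cite: Schoen1998HodgeWeilAddendum, §7 and §10 (proof of the Proposition)]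
[cite: vanGeemen1994HodgeAV, Lemma 5.2 (3)] -/
theorem weilDiscriminant_bilinOrthSum [Module.Finite K V₁] [Module.Finite K V₂]
    (E₁ : LinearMap.BilinForm ℚ V₁) (E₂ : LinearMap.BilinForm ℚ V₂) {α : K} {d : ℚ} (σ : K →+* K)
    (hd : 0 < d) (hα : α * α = algebraMap ℚ K (-d)) (hσα : σ α = -α)
    (hK : ∀ k : K, ∃ a b : ℚ, k = algebraMap ℚ K a + algebraMap ℚ K b * α)
    (hσ : ∀ k : K, k * σ k = algebraMap ℚ K (Algebra.norm ℚ k))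
    (hE₁ : ∀ x y : V₁, E₁ y x = -E₁ x y) (hW₁ : ∀ x y : V₁, E₁ (α • x) (α • y) = d * E₁ x y)
    (hN₁ : E₁.Nondegenerate)
    (hE₂ : ∀ x y : V₂, E₂ y x = -E₂ x y) (hW₂ : ∀ x y : V₂, E₂ (α • x) (α • y) = d * E₂ x y)
    (hN₂ : E₂.Nondegenerate) :
    weilDiscriminant (bilinOrthSum E₁ E₂) α = weilDiscriminant E₁ α * weilDiscriminant E₂ α := by
  show discrClass ℚ _ = discrClass ℚ _ * discrClass ℚ _
  rw [weilHermitianForm_bilinOrthSum, ← weilSesqForm_coe E₁ σ hd.ne' hα hW₁ hσα hK,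
    ← weilSesqForm_coe E₂ σ hd.ne' hα hW₂ hσα hK, ← sesqOrthSum_eq_formOrthSum]
  exact discrClass_sesqOrthSum ℚ hσ _ _
    (exists_units_algebraMap_eq_det_gramMatrix E₁ σ hd hα hE₁ hW₁ hN₁ hσα hK (Module.finBasis K V₁))
    (exists_units_algebraMap_eq_det_gramMatrix E₂ σ hd hα hE₂ hW₂ hN₂ hσα hK (Module.finBasis K V₂))

end Product

end Literature.AlgebraicGeometry.Motives

end
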